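import Mathlib
import HarnessLib
import Literature.MathematicalPhysics.QuantumLattice.GaugeGroups
import Literature.MathematicalPhysics.QuantumFieldTheory.ConstructiveQFTWave0
import Summits.Ventures.LatticeQCDFlow.Scaling.LatticeEntropySUN
import Summits.Ventures.LatticeQCDFlow.Scaling.LatticeEntropySU2
import Summits.Ventures.LatticeQCDFlow.Scaling.EntropyBudgetMeasure
import Summits.Ventures.LatticeQCDFlow.Scaling.EntropyBudgetFlow

/-!
# LatticeQCDFlow / Scaling — the volume × coupling law of exact flow samplers for `SU(N)`, `SU(2)`

HONEST FRAMING: exact (Metropolis-corrected) sampling algorithms for lattice gauge theory;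
figures of merit are autocorrelation/cost numbers at stated couplings and volumes; no
continuum-physics claim.

Venture `LatticeQCDFlow` (cell pub-lqcd), topic `Scaling`, THEORY-2.md §3.2 (h) v2.4 / §4 rows
T2-AG(m), T2-AI(m) (theory seat GEN-10).  The measure-form budget
`ESS ≤ C · exp(−D(μ_{Λ,β} ‖ Haar^{⊗E}))` (`Scaling/EntropyBudgetMeasure.lean`,
`Lattice.wilson_essM_le_rpow`) composed with the `SU(N)`
entropy growth law (`Scaling/LatticeEntropySUN.lean`, `Lattice.SUN.EntropyGrowthLaw`, OPEN for
`N ≥ 3` exactly to the extent of the two Haar action-ball items, PROVED for `N = 2` in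
`Scaling/LatticeEntropySU2.lean`):

* `SUN.essM_volume_law_of` — `EntropyGrowthLaw d N →` for every `L ≥ 2`, `β ≥ 1` and every model
  on `GaugeConfig d L SU(N)` with a measurable density `0 < g ≤ C` w.r.t. product Haar,
  `ESS ≤ C · e^{c·L^d} · β^{−(N²−1)((d−1)L^d(1/2 − 1/L) − 1/2)}` with `c` depending on `d, N` only;
* `SU2.essM_volume_law_two` — the same for `SU(2)` with exponent `3((d−1)L^d(1/2 − 1/L) − 1/2)`,
  UNCONDITIONALLY, in every dimension `d`;
* `SUN.essM_flow_volume_law_of` / `SU2.essM_flow_volume_law_two` — the same two laws for the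
  model of a FLOW `F` (a measurable bijection with exact Jacobian `ofReal ∘ j` w.r.t. product Haar,
  `Exactness.HasJacobian`; volume contraction `1/j ≤ K`; prior density `0 < r ≤ M`): `C = M·K`
  (`Scaling/EntropyBudgetFlow.lean`).

Reading (THEORY-2.md §0 item 3): for an exact flow sampler of `SU(2)` lattice gauge theory whose
model density against product Haar is bounded by `C` — `log C` is the flow's log-Jacobian /
density-concentration CAPACITY, at most (number of coupling layers) × (sites) × (per-site
log-Lipschitz bound) for the architectures in use — a non-collapsing ESS at coupling `β` on an
`L^d` torus forces `log C ≥ (3/2)(d−1)·L^d·(1 − 2/L)·log β − O(L^d)`: capacity EXTENSIVE in the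
volume and LOGARITHMIC in `β`.  References: Kanwar et al., Phys. Rev. Lett. 125 (2020) 121601 =
arXiv:2003.06413; Boyda et al., Phys. Rev. D 103 (2021) 074504 = arXiv:2008.05456 (`SU(N)` flows);
Abbott et al. arXiv:2211.07541 §IV and Del Debbio–Marsh Rossney–Wilson, Phys. Rev. D 104 (2021)
094507 = arXiv:2105.12481 §V (measured volume degradation of flow ESS); Chatterjee
arXiv:1602.01222 Thm 2.1 (the `(n/2)·log β` free energy asymptotics behind the growth law).
-/

noncomputable section

open MeasureTheory InformationTheory
open Literature.MathematicalPhysics.QuantumLattice Literature.MathematicalPhysics.QuantumFieldTheory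

namespace Summit.Ventures.LatticeQCDFlow.Theory2.Lattice

/-- **Volume × coupling law for `SU(N)`, conditional on the entropy growth law.**  From
`SUN.EntropyGrowthLaw d N` (lower bound) and `wilson_essM_le_rpow`. [folklore] -/
theorem SUN.essM_volume_law_of (d N : ℕ) (h : SUN.EntropyGrowthLaw d N) (hN : 1 ≤ N) :
    ∃ c : ℝ, ∀ (L : ℕ) [NeZero L], 2 ≤ L → ∀ β : ℝ, 1 ≤ β →
      ∀ (g : GaugeConfig d L (Matrix.specialUnitaryGroup (Fin N) ℂ) → ℝ) (C : ℝ),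
        Measurable g → (∀ U, 0 < g U) → (∀ U, g U ≤ C) →
          essM (wilsonMeasure (d := d) (L := L) (fundamentalRep (Fin N)) β)
              ((Measure.pi fun _ : Edge d L =>
                  haarProbability (Matrix.specialUnitaryGroup (Fin N) ℂ)).withDensity
                fun U => ENNReal.ofReal (g U)) ≤
            C * Real.exp (c * (L : ℝ) ^ d) *
              β ^ (-(((N : ℝ) ^ 2 - 1) *
                (((d : ℝ) - 1) * (L : ℝ) ^ d * (1 / 2 - 1 / L) - 1 / 2))) := by
  obtain ⟨c, hc⟩ := h hN
  refine ⟨c, fun L _ hL β hβ g C hg hg0 hgC => ?_⟩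
  have hD := (hc L hL β hβ).1
  exact wilson_essM_le_rpow (fundamentalRep (Fin N)) (continuous_fundamentalRep (Fin N))
    (SUN.re_trace_le N) hβ (by linarith) hg hg0 hgC

/-- **THE VOLUME × COUPLING LAW OF EXACT FLOW SAMPLERS FOR `SU(2)`, UNCONDITIONAL** (every
dimension `d`): there is `c = c(d)` such that for all `L ≥ 2`, `β ≥ 1` and EVERY model on
`GaugeConfig d L SU(2)` with a measurable density `0 < g ≤ C` against product Haar, the exact
(reweighted / independence-Metropolis) sampler of the Wilson measure has
`ESS ≤ C · e^{c L^d} · β^{−3((d−1)L^d(1/2 − 1/L) − 1/2)}`. [folklore] -/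
theorem SU2.essM_volume_law_two (d : ℕ) :
    ∃ c : ℝ, ∀ (L : ℕ) [NeZero L], 2 ≤ L → ∀ β : ℝ, 1 ≤ β →
      ∀ (g : GaugeConfig d L (Matrix.specialUnitaryGroup (Fin 2) ℂ) → ℝ) (C : ℝ),
        Measurable g → (∀ U, 0 < g U) → (∀ U, g U ≤ C) →
          essM (wilsonMeasure (d := d) (L := L) (fundamentalRep (Fin 2)) β)
              ((Measure.pi fun _ : Edge d L =>
                  haarProbability (Matrix.specialUnitaryGroup (Fin 2) ℂ)).withDensity
                fun U => ENNReal.ofReal (g U)) ≤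
            C * Real.exp (c * (L : ℝ) ^ d) *
              β ^ (-(3 * (((d : ℝ) - 1) * (L : ℝ) ^ d * (1 / 2 - 1 / L) - 1 / 2))) := by
  obtain ⟨c, hc⟩ := SUN.essM_volume_law_of d 2 (SU2.entropyGrowthLaw_two d) (by norm_num)
  refine ⟨c, fun L _ hL β hβ g C hg hg0 hgC => ?_⟩
  have h := hc L hL β hβ g C hg hg0 hgC
  have h3 : ((2 : ℕ) : ℝ) ^ 2 - 1 = 3 := by norm_num
  rw [h3] at h
  exact h

/-- The same law read as a CAPACITY BOUND: if the sampler keeps `ESS ≥ e^{−t}` then the model's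
sup-density satisfies `log C ≥ 3((d−1)L^d(1/2 − 1/L) − 1/2)·log β − c·L^d − t`. [folklore] -/
theorem SU2.log_capacity_ge_two (d : ℕ) :
    ∃ c : ℝ, ∀ (L : ℕ) [NeZero L], 2 ≤ L → ∀ β : ℝ, 1 ≤ β →
      ∀ (g : GaugeConfig d L (Matrix.specialUnitaryGroup (Fin 2) ℂ) → ℝ) (C t : ℝ),
        Measurable g → (∀ U, 0 < g U) → (∀ U, g U ≤ C) →
          Real.exp (-t) ≤ essM (wilsonMeasure (d := d) (L := L) (fundamentalRep (Fin 2)) β)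
              ((Measure.pi fun _ : Edge d L =>
                  haarProbability (Matrix.specialUnitaryGroup (Fin 2) ℂ)).withDensity
                fun U => ENNReal.ofReal (g U)) →
            3 * (((d : ℝ) - 1) * (L : ℝ) ^ d * (1 / 2 - 1 / L) - 1 / 2) * Real.log β -
                c * (L : ℝ) ^ d - t ≤ Real.log C := by
  obtain ⟨c, hc⟩ := SU2.essM_volume_law_two d
  refine ⟨c, fun L _ hL β hβ g C t hg hg0 hgC hess => ?_⟩
  have hβ0 : 0 < β := one_pos.trans_le hβ
  have hC : 0 < C := (hg0 fun _ => 1).trans_le (hgC fun _ => 1)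
  have h := (hess.trans (hc L hL β hβ g C hg hg0 hgC))
  -- take logarithms
  have hpos : 0 < C * Real.exp (c * (L : ℝ) ^ d) *
      β ^ (-(3 * (((d : ℝ) - 1) * (L : ℝ) ^ d * (1 / 2 - 1 / L) - 1 / 2))) := by positivity
  have hlog := Real.log_le_log (Real.exp_pos _) h
  rw [Real.log_exp, Real.log_mul (by positivity) (Real.rpow_pos_of_pos hβ0 _).ne',
    Real.log_mul hC.ne' (Real.exp_pos _).ne', Real.log_exp, Real.log_rpow hβ0] at hlog
  linarith

/-! ## The same laws for the model of a flow (`C = M·K`) -/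

/-- **Volume × coupling law for FLOWS of `SU(N)` configurations, conditional on the entropy
growth law.**  Flow `F` with exact Jacobian `ofReal ∘ j` w.r.t. product Haar, contraction
`1/j ≤ K`, prior density `0 < r ≤ M`: `ESS ≤ M·K·e^{cL^d}·β^{−(N²−1)(…)}`. [folklore] -/
theorem SUN.essM_flow_volume_law_of (d N : ℕ) (h : SUN.EntropyGrowthLaw d N) (hN : 1 ≤ N) :
    ∃ c : ℝ, ∀ (L : ℕ) [NeZero L], 2 ≤ L → ∀ β : ℝ, 1 ≤ β →
      ∀ (F : GaugeConfig d L (Matrix.specialUnitaryGroup (Fin N) ℂ) ≃ᵐ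
          GaugeConfig d L (Matrix.specialUnitaryGroup (Fin N) ℂ))
        (j r : GaugeConfig d L (Matrix.specialUnitaryGroup (Fin N) ℂ) → ℝ) (K M : ℝ),
        Exactness.HasJacobian (Measure.pi fun _ : Edge d L =>
            haarProbability (Matrix.specialUnitaryGroup (Fin N) ℂ)) F
          (fun V => ENNReal.ofReal (j V)) →
        Measurable j → (∀ V, 0 < j V) → (∀ V, (j V)⁻¹ ≤ K) →
        Measurable r → (∀ V, 0 < r V) → (∀ V, r V ≤ M) →
          essM (wilsonMeasure (d := d) (L := L) (fundamentalRep (Fin N)) β)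
              (Measure.map F ((Measure.pi fun _ : Edge d L =>
                  haarProbability (Matrix.specialUnitaryGroup (Fin N) ℂ)).withDensity
                fun V => ENNReal.ofReal (r V))) ≤
            M * K * Real.exp (c * (L : ℝ) ^ d) *
              β ^ (-(((N : ℝ) ^ 2 - 1) *
                (((d : ℝ) - 1) * (L : ℝ) ^ d * (1 / 2 - 1 / L) - 1 / 2))) := by
  obtain ⟨c, hc⟩ := h hN
  refine ⟨c, fun L _ hL β hβ F j r K M hF hj hj0 hjK hr hr0 hrM => ?_⟩
  have hD := (hc L hL β hβ).1
  exact wilson_essM_flow_le_rpow (fundamentalRep (Fin N)) (continuous_fundamentalRep (Fin N))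
    (SUN.re_trace_le N) hβ (by linarith) hF hj hj0 hjK hr hr0 hrM

/-- **THE VOLUME × COUPLING LAW FOR EXACT FLOW SAMPLERS OF `SU(2)`, FLOW FORM, UNCONDITIONAL:**
`∃ c = c(d)`, for all `L ≥ 2`, `β ≥ 1`, every flow `F` of `GaugeConfig d L SU(2)` with exact
Jacobian `ofReal ∘ j` w.r.t. product Haar and volume contraction `1/j ≤ K`, and every prior of
density `0 < r ≤ M`: `ESS ≤ M·K·e^{cL^d}·β^{−3((d−1)L^d(1/2 − 1/L) − 1/2)}` — so at fixed ESS,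
`log M + log K ≥ (3/2)(d−1)L^d(1 − 2/L)·log β − (3/2)log β − c·L^d − log(1/ESS)`. [folklore] -/
theorem SU2.essM_flow_volume_law_two (d : ℕ) :
    ∃ c : ℝ, ∀ (L : ℕ) [NeZero L], 2 ≤ L → ∀ β : ℝ, 1 ≤ β →
      ∀ (F : GaugeConfig d L (Matrix.specialUnitaryGroup (Fin 2) ℂ) ≃ᵐ
          GaugeConfig d L (Matrix.specialUnitaryGroup (Fin 2) ℂ))
        (j r : GaugeConfig d L (Matrix.specialUnitaryGroup (Fin 2) ℂ) → ℝ) (K M : ℝ),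
        Exactness.HasJacobian (Measure.pi fun _ : Edge d L =>
            haarProbability (Matrix.specialUnitaryGroup (Fin 2) ℂ)) F
          (fun V => ENNReal.ofReal (j V)) →
        Measurable j → (∀ V, 0 < j V) → (∀ V, (j V)⁻¹ ≤ K) →
        Measurable r → (∀ V, 0 < r V) → (∀ V, r V ≤ M) →
          essM (wilsonMeasure (d := d) (L := L) (fundamentalRep (Fin 2)) β)
              (Measure.map F ((Measure.pi fun _ : Edge d L =>
                  haarProbability (Matrix.specialUnitaryGroup (Fin 2) ℂ)).withDensity
                fun V => ENNReal.ofReal (r V))) ≤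
            M * K * Real.exp (c * (L : ℝ) ^ d) *
              β ^ (-(3 * (((d : ℝ) - 1) * (L : ℝ) ^ d * (1 / 2 - 1 / L) - 1 / 2))) := by
  obtain ⟨c, hc⟩ := SUN.essM_flow_volume_law_of d 2 (SU2.entropyGrowthLaw_two d) (by norm_num)
  refine ⟨c, fun L _ hL β hβ F j r K M hF hj hj0 hjK hr hr0 hrM => ?_⟩
  have h := hc L hL β hβ F j r K M hF hj hj0 hjK hr hr0 hrM
  have h3 : ((2 : ℕ) : ℝ) ^ 2 - 1 = 3 := by norm_num
  rw [h3] at h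
  exact h

end Summit.Ventures.LatticeQCDFlow.Theory2.Lattice

end
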